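import Summits.CriticalPhenomena.SAWScalingLimit.Theorems.SAWDevelopingMapHexConjectureKPDefs
import HarnessLib

/-!
# Crux `HexConjecture` (stmt-CriticalPhenomena-0808), line `root-locality-replaces-loewner`:
the parafermionic identity of the off-centred triangle `T_{K,I}` (Krachun–Panagiotis, Lemma 3.1)

Landing target:
`Summits/CriticalPhenomena/SAWScalingLimit/Theorems/SAWDevelopingMapHexConjectureKPTriangleTwo.lean`
(`--supports stmt-CriticalPhenomena-0808`; registered sub-goal `stub_kp_tri2_identity`).

In the proof of [KP, Lemma 3.1] the prefix of a walk of `Tria_{2k+1} = T_k` up to a renewal crossing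
of the line `slev = i ∣ i+1` is a walk of the OFF-CENTRED triangle `T_{k,i} = T_k ∩ {slev ≤ i}`
(`triV₂ K I` of the definitions file) from the root `a` to its right side, and KP bound the mass
`Δ_{k,i}` of the walks of `T_{k,i}` to its two far sides by `D_{2i+1}`: "since there are more SAWs in
`T_{k,i}` that start at `0` and end on the real axis than SAWs in `Tria_{2i+1}` …, we can use the
observable as in the proof of Lemma 2.3 to deduce that `Δ_{k,i} ≤ D_{2i+1}`".  This file proves, in the
coordinate model `HV` and verbatim along Glazman–Manolescu's Lemma 4.1 (`HV.tri_identity`,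
`HexSAWTriangle.lean`):

* the classification of the boundary half-edges of `T_{K,I}` (`I ≤ K`): base (class `α`), left side
  `x₀ = -K ∣ -K-1` (class `IsLeftDart K`), right side `slev = I ∣ I+1` (class `IsRightDart I`)
  (`not_mem_triV₂_iff_classes`, `tri₂_boundary_iff`);
* the winding `-π/3` and the boundary weight `cos(π/8)` of the right exits of any domain of the upper
  half-plane lying behind the line `slev = I ∣ I+1` (`pturn_of_isRightDart₂`,
  `boundaryTerm_re_of_isRightDart₂`; the left exits and the base are those of `T_K ⊆ S_{2K+1,K}`);
* **the identity** `cos(3π/8)·triA₂ K I + cos(π/8)·(triDl₂ K I + triDr₂ K I) = 1` (`tri₂_identity`,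
  from `HV.boundary_sum`), the comparison `triA I ≤ triA₂ K I` (`T_I ⊆ T_{K,I}`) and KP's bound
  `Δ_{k,i} ≤ D_{2i+1}`: `triDl₂ K I + triDr₂ K I ≤ 2·triDl I` (`triD₂_le`);
* the registered sub-goal `stub_kp_tri2_identity` (both facts).

Sources: Krachun–Panagiotis (arXiv:2310.17299), proof of Lemma 3.1; Glazman–Manolescu 2020, Lemma 4.1;
Duminil-Copin–Smirnov 2012, Lemma 1.
-/

noncomputable section

open Finset
open Literature.Probability.RandomPlanarGeometry.SAW Literature.Probability.RandomPlanarGeometry.SAW.HV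

namespace Summit.CriticalPhenomena.SAWScalingLimit.Theorems.HexConjecture.RootLocality

open Real Hopf

/-! ### Geometry of `T_{K,I}` -/

/-- `T_{K,I}` lies in the upper half-plane. [cite: KrachunPanagiotis2026, proof of Lemma 3.1 (T_{k,i})] -/
theorem triV₂_upper {K I : ℕ} : ∀ w ∈ triV₂ K I, 0 ≤ w.2.1 := fun _ hw => (mem_triV₂_iff.1 hw).1

/-- The origin is a vertex of `T_{K,I}`. [cite: KrachunPanagiotis2026, proof of Lemma 3.1 (T_{k,i})] -/
theorem hvOrigin_mem_triV₂ (K I : ℕ) : hvOrigin ∈ triV₂ K I := by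
  rw [mem_triV₂_iff]; simp [hvOrigin]

/-- On `T_{K,I}`, `(pos x).1 + (pos x).2 ≤ 3I + 2`: the domain lies behind its right side
`slev = I ∣ I+1`. [cite: KrachunPanagiotis2026, proof of Lemma 3.1 (R_{k,i})] -/
theorem pos_add_le_of_mem_triV₂ {K I : ℕ} {x : HV} (hx : x ∈ triV₂ K I) :
    (pos x).1 + (pos x).2 ≤ 3 * I + 2 := by
  have h := (mem_triV₂_iff.1 hx).2.2.1
  obtain ⟨a, b, c⟩ := x; cases c <;> simp [pos, bit, slev] at h ⊢ <;> omega

/-- `T_{K,I} ⊆ T_K ⊆ S_{2K+1,K}`. [cite: KrachunPanagiotis2026, proof of Lemma 3.1 (T_{k,i} ⊆ Tria_{2k+1})] -/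
theorem triV₂_subset_stripV (K I : ℕ) : triV₂ K I ⊆ stripV (2 * K + 1) K :=
  (triV₂_subset K I).trans (triV_subset_stripV le_rfl le_rfl)

/-! ### The three classes of boundary half-edges of `T_{K,I}` -/

/-- **The boundary of `T_{K,I}` (`I ≤ K`) is base ∪ left side ∪ right side**: a half-edge from a
vertex of `T_{K,I}` leaves it iff it is of class `α` (base), left (at `x₀ = -K`) or right (across
`slev = I ∣ I+1`). [cite: KrachunPanagiotis2026, proof of Lemma 3.1 (R_{k,i}, L_{k,i})] -/
theorem not_mem_triV₂_iff_classes {K I : ℕ} (hIK : I ≤ K) {v u : HV} (hv : v ∈ triV₂ K I)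
    (hadj : hvGraph.Adj v u) :
    u ∉ triV₂ K I ↔ IsAlphaDart (v, u) ∨ IsLeftDart K (v, u) ∨ IsRightDart I (v, u) := by
  obtain ⟨a, b, c⟩ := v
  obtain ⟨a', b', c'⟩ := u
  rw [mem_triV₂_iff] at hv ⊢
  cases c <;> cases c' <;> simp only [hvGraph_adj, AdjRel] at hadj <;> simp at hadj <;>
    rcases hadj with ⟨rfl, rfl⟩ | ⟨rfl, rfl⟩ | ⟨rfl, rfl⟩ <;>
    simp [IsAlphaDart, IsLeftDart, IsRightDart, bit, slev] at hv ⊢ <;> omega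

/-- The left class (at `-K`) and the right class (at `I`) are disjoint. [folklore] -/
theorem not_isRightDart_of_isLeftDart₂ {K I : ℕ} {d : HV × HV} (h : IsLeftDart K d) :
    ¬ IsRightDart I d := fun h' => by
  have e := h.2.2; rw [h'.2.2] at e; simp only [Prod.mk.injEq] at e; omega

/-- For a walk of `T_{K,I}` (`I ≤ K`) from `a`: it is a nontrivial walk to a boundary mid-edge iff its
final half-edge is of class `α`, left (at `-K`) or right (at `I`).
[cite: KrachunPanagiotis2026, proof of Lemma 3.1 (R_{k,i}, L_{k,i})] -/
theorem tri₂_boundary_iff {K I : ℕ} (hIK : I ≤ K) {P : List HV} (hP : IsMidWalk (triV₂ K I) P) :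
    (P ≠ [wOut, hvOrigin] ∧ (finalDart P).2 ∉ triV₂ K I) ↔
      (IsAlphaDart (finalDart P) ∨ IsLeftDart K (finalDart P) ∨ IsRightDart I (finalDart P)) := by
  rcases hP.trivial_or_exists with rfl | ⟨l, u, hl, rfl⟩
  · simp only [ne_eq, not_true_eq_false, false_and, finalDart_trivial, false_iff, not_or]
    refine ⟨fun h => ?_, fun h => ?_, fun h => ?_⟩
    · have := h.1; simp [wOut] at this
    · have := h.2.1; simp [wOut] at this
    · have := h.2.1; simp [wOut] at this
  · obtain ⟨-, -, hadj, hlV, -, -⟩ := (isMidWalk_cons_append_iff _ hl u).1 hP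
    rw [finalDart_cons_append hl]
    rw [← not_mem_triV₂_iff_classes hIK (hlV _ (List.getLast_mem hl)) hadj]
    have hne : wOut :: (l ++ [u]) ≠ [wOut, hvOrigin] := by
      intro h
      have := congrArg List.length h
      simp only [List.length_cons, List.length_append, List.length_nil] at this
      exact hl (List.eq_nil_of_length_eq_zero (by omega))
    exact ⟨fun h => h.2, fun h => ⟨hne, h⟩⟩

/-! ### Winding and boundary weight of the right exits -/

/-- **Winding to the line `slev = I ∣ I+1` is `-π/3`**: a self-avoiding walk from `a` in a domain `V`
of the upper half-plane lying behind that line (`(pos x).1 + (pos x).2 ≤ 3I+2` on `V`) and leaving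
through a right half-edge at `slev = I` turns in total by `-π/3` (`pturn = -1`): Hopf's formula
`HV.pturn_walk_eq` with the rotation `ω` (verbatim `HV.pturn_of_isRightDart`).
[cite: GlazmanManolescu2019, proof of Lemma 4.1 ("the winding of walks from a to b are all equal")] -/
theorem pturn_of_isRightDart₂ {V : Finset HV} {I : ℕ} {P : List HV} (hV : ∀ w ∈ V, 0 ≤ w.2.1)
    (hVI : ∀ x ∈ V, (pos x).1 + (pos x).2 ≤ 3 * I + 2) (hP : IsMidWalk V P)
    (hR : IsRightDart I (finalDart P)) : pturn P = -1 := by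
  -- adapted from HV.pturn_of_isRightDart (HexSAWTriangle.lean)
  rcases hP.trivial_or_exists with rfl | ⟨l, u, hl, rfl⟩
  · exact absurd hR.2.1 (by simp [finalDart, wOut])
  rw [finalDart_cons_append hl] at hR
  obtain ⟨h1, h2, h3⟩ := hR
  dsimp only at h1 h2 h3
  obtain ⟨-, -, -, hlV, -, -⟩ := (isMidWalk_cons_append_iff _ hl u).1 hP
  set v := l.getLast hl with hv
  have hvV : v ∈ V := hlV _ (List.getLast_mem hl)
  have hb := hV v hvV
  have hposv : pos v = (3 * v.1 + 1, 3 * v.2.1 + 1) := by simp [pos, h2]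
  have hposu : pos u = (3 * v.1 + 2, 3 * v.2.1 + 2) := by rw [h3]; simp [pos]
  have him : ∀ X : ℤ × ℤ, (omg * emb X).im = ((X.1 + X.2 : ℤ) : ℝ) * (Real.sqrt 3 / 2) := by
    intro X
    rw [show omg * emb X = -(emb (rot4 X)) by rw [emb_rot4]; ring, Complex.neg_im, emb_im]
    simp only [rot4]; push_cast; ring
  have key := pturn_walk_eq hV hl hP ?_ ?_ ?_ omg_ne_zero (c := omg) ?_ ?_
  · apply int_eq_of_pi_div_three_mul
    rw [key, hposu, pos_wOut, show ((3 * v.1 + 2, 3 * v.2.1 + 2) - (2, -1) : ℤ × ℤ) =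
      (3 * v.1, 3 * v.2.1 + 3) by simp only [Prod.mk_sub_mk, Prod.mk.injEq]; constructor <;> ring,
      arg_omg_mul]
    · push_cast; ring
    · dsimp only; omega
    · dsimp only; omega
  · intro huV
    have h4 := hVI u huV
    rw [hposu] at h4
    dsimp only at h4
    omega
  · rw [h3]; simp only [wOut, Ne, Prod.mk.injEq]; omega
  · rw [hposu]; dsimp only; omega
  · refine forall_mem_walk ?_ (fun x hx => ?_) ?_
    · rw [him, hposu, pos_wOut]; simp only [Prod.fst_sub, Prod.snd_sub]
      have : (0 : ℝ) ≤ ((3 * v.1 + 2 - 2 + (3 * v.2.1 + 2 - (-1)) : ℤ) : ℝ) := by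
        exact_mod_cast (by omega)
      positivity
    · rw [him, hposu]; simp only [Prod.fst_sub, Prod.snd_sub]
      have h4 := hVI x (hlV x hx)
      have : (0 : ℝ) ≤ ((3 * v.1 + 2 - (pos x).1 + (3 * v.2.1 + 2 - (pos x).2) : ℤ) : ℝ) := by
        exact_mod_cast (by omega)
      positivity
    · rw [sub_self, him]; simp
  · rw [hposu, hposv, show ((3 * v.1 + 2, 3 * v.2.1 + 2) - (3 * v.1 + 1, 3 * v.2.1 + 1) : ℤ × ℤ) =
        (1, 1) by simp only [Prod.mk_sub_mk, Prod.mk.injEq]; constructor <;> ring]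
    have e : omg * emb (1, 1) = emb (-1, 2) := by
      have h2' := omg_sq
      simp only [emb]; push_cast
      linear_combination h2'
    rw [e]; exact arg_emb_neg_one_two

/-- **Boundary term on the line `slev = I ∣ I+1`**: direction `1 + ω = ω̄ e₀`, winding `-π/3`: the
real part of the term is `cos(π/8)` (verbatim `HV.boundaryTerm_re_of_isRightDart`).
[cite: GlazmanManolescu2019, §4.1 (caption of Fig. 7: "each walk ending on β^Δ has total weight cos(π/8)")] -/
theorem boundaryTerm_re_of_isRightDart₂ {V : Finset HV} {I : ℕ} {P : List HV}
    (hV : ∀ w ∈ V, 0 ≤ w.2.1) (hVI : ∀ x ∈ V, (pos x).1 + (pos x).2 ≤ 3 * I + 2)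
    (hP : IsMidWalk V P) (hR : IsRightDart I (finalDart P)) :
    (edir (finalDart P).1 (finalDart P).2 * lam ^ pturn P / emb (-1, 2)).re = Real.cos (π / 8) := by
  -- adapted from HV.boundaryTerm_re_of_isRightDart (HexSAWTriangle.lean)
  have h0 := pturn_of_isRightDart₂ hV hVI hP hR
  rcases hP.trivial_or_exists with rfl | ⟨l, u, hl, rfl⟩
  · exact absurd hR.2.1 (by simp [finalDart, wOut])
  rw [h0, finalDart_cons_append hl]
  rw [finalDart_cons_append hl] at hR
  obtain ⟨-, h2, h3⟩ := hR
  dsimp only at h2 h3 ⊢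
  have he : edir (l.getLast hl) u = lam ^ (-8 : ℤ) * emb (-1, 2) := by
    rw [lam_zpow_neg_eight, edir, h3,
      show pos (l.getLast hl) = (3 * (l.getLast hl).1 + 1, 3 * (l.getLast hl).2.1 + 1) by
        simp [pos, h2]]
    simp only [pos, if_true]
    rw [show ((3 * (l.getLast hl).1 + 2, 3 * (l.getLast hl).2.1 + 2) -
        (3 * (l.getLast hl).1 + 1, 3 * (l.getLast hl).2.1 + 1) : ℤ × ℤ) = (1, 1) by
      simp only [Prod.mk_sub_mk, Prod.mk.injEq]; constructor <;> ring]
    have h2' := omg_sq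
    have h3' := omg_pow_three
    simp only [emb]; push_cast
    linear_combination (-1 : ℂ) * h2' + 2 * h3'
  rw [he, mul_div_right_comm, mul_div_assoc, div_self emb_neg_one_two_ne_zero, mul_one,
    ← zpow_add₀ lam_ne_zero, lam_zpow_re, show (((-8 + -1 : ℤ)) : ℝ) * θ₅ = -(9 * θ₅) by
      push_cast; ring, Real.cos_neg]
  exact cos_nine_mul_θ₅

/-! ### The identity of `T_{K,I}` and KP's bound `Δ_{k,i} ≤ D_{2i+1}` -/

/-- **The parafermionic identity of the off-centred triangle `T_{K,I}`** (`I ≤ K`):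
`cos(3π/8)·A + cos(π/8)·(left exits + right exits) = 1` — "we can use the observable as in the proof
of Lemma 2.3": the summed vertex relation `HV.boundary_sum` over `V(T_{K,I})`, the classification
`tri₂_boundary_iff` and the boundary windings `∓π` (base), `+π/3` (left side of `T_K`), `-π/3` (the
line `slev = I ∣ I+1`). [cite: KrachunPanagiotis2026, proof of Lemma 3.1 (Δ_{k,i} ≤ D_{2i+1})] -/
theorem tri₂_identity {K I : ℕ} (hIK : I ≤ K) :
    Real.cos (3 * π / 8) * triA₂ K I + Real.cos (π / 8) * (triDl₂ K I + triDr₂ K I) = 1 := by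
  -- adapted from HV.tri_identity (HexSAWTriangle.lean)
  have hbs := boundary_sum (V := triV₂ K I) triV₂_upper (hvOrigin_mem_triV₂ K I)
  rw [edir_wOut_hvOrigin, Finset.sum_filter] at hbs
  have hsub : triV₂ K I ⊆ stripV (2 * K + 1) K := triV₂_subset_stripV K I
  have hsubK : triV₂ K I ⊆ triV K := triV₂_subset K I
  have hVI : ∀ x ∈ triV₂ K I, (pos x).1 + (pos x).2 ≤ 3 * I + 2 :=
    fun x hx => pos_add_le_of_mem_triV₂ hx
  have hpt : ∀ P ∈ midWalks (triV₂ K I),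
      ((if P ≠ [wOut, hvOrigin] ∧ (finalDart P).2 ∉ triV₂ K I then
          edir (finalDart P).1 (finalDart P).2 * pwt P else 0) / emb (-1, 2)).re =
        hexCriticalFugacity ^ mwLen P *
          ((if IsAlphaDart (finalDart P) then Real.cos (3 * π / 8) else 0) +
            (if IsLeftDart K (finalDart P) then Real.cos (π / 8) else 0) +
            (if IsRightDart I (finalDart P) then Real.cos (π / 8) else 0)) := by
    intro P hP
    rw [mem_midWalks_iff] at hP
    have hiff := tri₂_boundary_iff hIK hP
    by_cases hα : IsAlphaDart (finalDart P)
    · rw [if_pos (hiff.2 (Or.inl hα)), re_div_e₀, boundaryTerm_re_of_isAlphaDart (hP.mono hsub) hα,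
        if_pos hα, if_neg (not_isLeftDart_of_isAlphaDart hα),
        if_neg (not_isRightDart_of_isAlphaDart hα)]
      ring
    by_cases hl : IsLeftDart K (finalDart P)
    · rw [if_pos (hiff.2 (Or.inr (Or.inl hl))), re_div_e₀,
        boundaryTerm_re_of_isLeftDart (hP.mono hsubK) hl,
        if_neg hα, if_pos hl, if_neg (not_isRightDart_of_isLeftDart₂ hl)]
      ring
    by_cases hr : IsRightDart I (finalDart P)
    · rw [if_pos (hiff.2 (Or.inr (Or.inr hr))), re_div_e₀,
        boundaryTerm_re_of_isRightDart₂ triV₂_upper hVI hP hr,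
        if_neg hα, if_neg hl, if_pos hr]
      ring
    · rw [if_neg (by rw [hiff]; push Not; exact ⟨hα, hl, hr⟩), zero_div, Complex.zero_re,
        if_neg hα, if_neg hl, if_neg hr]
      ring
  have key := congrArg (fun z => (z / emb (-1, 2)).re) hbs
  rw [div_self emb_neg_one_two_ne_zero, Complex.one_re, Finset.sum_div, Complex.re_sum,
    Finset.sum_congr rfl hpt] at key
  have hA : ∑ P ∈ midWalks (triV₂ K I), hexCriticalFugacity ^ mwLen P *
      (if IsAlphaDart (finalDart P) then Real.cos (3 * π / 8) else 0) =
        Real.cos (3 * π / 8) * triA₂ K I := by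
    rw [triA₂, Finset.mul_sum, Finset.sum_filter]
    refine Finset.sum_congr rfl fun P _ => ?_
    split_ifs <;> ring
  have hDl : ∑ P ∈ midWalks (triV₂ K I), hexCriticalFugacity ^ mwLen P *
      (if IsLeftDart K (finalDart P) then Real.cos (π / 8) else 0) =
        Real.cos (π / 8) * triDl₂ K I := by
    rw [triDl₂, Finset.mul_sum, Finset.sum_filter]
    refine Finset.sum_congr rfl fun P _ => ?_
    split_ifs <;> ring
  have hDr : ∑ P ∈ midWalks (triV₂ K I), hexCriticalFugacity ^ mwLen P *
      (if IsRightDart I (finalDart P) then Real.cos (π / 8) else 0) =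
        Real.cos (π / 8) * triDr₂ K I := by
    rw [triDr₂, Finset.mul_sum, Finset.sum_filter]
    refine Finset.sum_congr rfl fun P _ => ?_
    split_ifs <;> ring
  rw [mul_add, ← key, ← hA, ← hDl, ← hDr, ← Finset.sum_add_distrib, ← Finset.sum_add_distrib]
  refine Finset.sum_congr rfl fun P _ => ?_
  ring

/-- **`A^Δ_{2I+1} ≤ A` of `T_{K,I}`** for `I ≤ K`: "there are more SAWs in `T_{k,i}` that start at `0`
and end on the real axis than SAWs in `Tria_{2i+1}` that start at `0` and end on the real axis"
(`T_I ⊆ T_{K,I}`, same base class). [cite: KrachunPanagiotis2026, proof of Lemma 3.1] -/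
theorem triA_le_triA₂ {K I : ℕ} (h : I ≤ K) : triA I ≤ triA₂ K I := by
  unfold triA triA₂
  apply sum_le_sum_of_subset_of_nonneg
  · intro P hP
    rw [mem_filter] at hP ⊢
    exact ⟨midWalks_mono (triV_subset_triV₂ h) hP.1, hP.2⟩
  · exact fun _ _ _ => pow_nonneg hexCriticalFugacity_pos_lt_one.1.le _

/-- **Krachun–Panagiotis's bound `Δ_{k,i} ≤ D_{2i+1}`**: the mass of the walks of `T_{K,I}` from `a` to
its two far sides is at most `2·triDl I = D^Δ_{2I+1}` (the identity of `T_{K,I}`, the identity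
`HV.tri_identity'` of `T_I`, `A^Δ_{2I+1} ≤ A(T_{K,I})` and `cos(π/8) > 0`).
[cite: KrachunPanagiotis2026, proof of Lemma 3.1 (Δ_{k,i} ≤ D_{2i+1})] -/
theorem triD₂_le {K I : ℕ} (h : I ≤ K) : triDl₂ K I + triDr₂ K I ≤ 2 * triDl I := by
  have h1 := tri₂_identity h
  have h2 := tri_identity' I
  have hA := triA_le_triA₂ h
  have hc := cos_pi_div_eight_pos
  have hc' := cos_three_pi_div_eight_pos
  nlinarith

/-- **Registered sub-goal `stub_kp_tri2_identity`** (crux item stmt-CriticalPhenomena-0808, line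
`root-locality-replaces-loewner`): for `I ≤ K`, the parafermionic identity of the off-centred triangle
`T_{K,I}`, `cos(3π/8)·triA₂ K I + cos(π/8)·(triDl₂ K I + triDr₂ K I) = 1`, and Krachun–Panagiotis's
consequence `Δ_{k,i} ≤ D_{2i+1}`: `triDl₂ K I + triDr₂ K I ≤ 2·triDl I`.
[cite: KrachunPanagiotis2026, proof of Lemma 3.1 (Δ_{k,i} ≤ D_{2i+1})] -/
theorem stub_kp_tri2_identity : ∀ (K I : ℕ), I ≤ K → Real.cos (3 * Real.pi / 8) * triA₂ K I + Real.cos (Real.pi / 8) * (triDl₂ K I + triDr₂ K I) = 1 ∧ triDl₂ K I + triDr₂ K I ≤ 2 * Literature.Probability.RandomPlanarGeometry.SAW.HV.triDl I :=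
  fun _ _ h => ⟨tri₂_identity h, triD₂_le h⟩

end Summit.CriticalPhenomena.SAWScalingLimit.Theorems.HexConjecture.RootLocality

end
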